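import Summits.CriticalPhenomena.CardyFormulaZ2.Theorems.CardyFlipRussoVoronoiHubFromSmirnovDefs
import Literature.Probability.LatticeModels.DelaunayGraph

/-!
# Stub `delaunay_pivot_exists_third` of line `moebius-exact-delaunay-dilation-ward`
# (crux `VoronoiHubFromSmirnov`, stmt-CriticalPhenomena-6433)

DELAUNAY PIVOTING in the plane.  Let `ω ⊆ ℂ` be locally finite (finitely many sites in every
compact set), let `p ≠ q` be a Delaunay pair of `ω` (empty circumscribed disc rule
`Literature.Probability.LatticeModels.IsDelaunayPair`: some closed disc has `p`, `q` on its boundary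
and no site of `ω` in its interior), and suppose some site of `ω` lies strictly to the LEFT of the
directed line `p → q`, i.e. `0 < Im (conj (q − p) · (d − p))`.  Then there is an empty circumscribed
disc through `p`, `q` whose boundary circle passes through a THIRD site `z ∈ ω` lying strictly to
the left of `p → q`.  This reduces Delaunay adjacency to in-circle tests of triples of sites, the
form in which it is transported by the near-Möbius behaviour of conformal maps on small scales
(I. Benjamini, O. Schramm, *Conformal invariance of Voronoi percolation*, Comm. Math. Phys. 197
(1998), proof of Thm 2.1, §4); classical computational-geometry folklore ("edge pivoting" in the
gift-wrapping construction of the Delaunay triangulation, Boissonnat–Yvinec 1998, §17.3).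

Proof (planar algebra only).  The centres equidistant from `p` and `q` form the pencil
`c(t) = p + (1/2 + t i)(q − p)`, `t : ℝ` (`dp_center_param`), and for every `d`

  `dist(d, c t)² − dist(p, c t)² = A(d) − 2 t σ(d)`,
  `σ(d) = Im (conj (q − p)(d − p))`, `A(d) = |d − p|² − Re (conj (q − p)(d − p))`   (`dp_key`).

Hence the disc `D(t)` of centre `c t` through `p`, `q` avoids `d` iff `2 t σ(d) ≤ A(d)`: a closed
upper bound `t ≤ τ(d)` (`2 τ(d) σ(d) = A(d)`) for sites on the left (`σ > 0`), a condition that only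
weakens as `t` grows for the other sites.  Starting from an admissible `t₀` (the given empty disc),
every left site has `τ(d) ≥ t₀`; the left sites with `τ(d) ≤ τ(d₀)` all lie in the compact disc
`D(τ d₀)`, hence are finitely many, and a left site `z` minimising `τ` among them
(`Finset.exists_min_image`) gives the admissible parameter `t* = τ(z)` at which `z` is ON the circle
(`dp_pivot_of_pencil`).

No new definitions.
-/

noncomputable section

namespace Summit.CriticalPhenomena.CardyFormulaZ2.Cruxes.VoronoiHubFromSmirnov.MoebiusExactDelaunayDilationWard

/-- **The pencil identity.** For the centre `c t = p + (1/2 + t i)(q − p)` on the perpendicular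
bisector of `[p, q]` and any point `d`,
`dist(d, c t)² − dist(p, c t)² = (|d − p|² − Re (conj (q − p)(d − p))) − 2 t · σ(d)`,
`σ(d) = Im (conj (q − p)(d − p))`: the power of `d` with respect to the circle through `p`, `q`
centred at `c t` is affine in `t`, with slope `−2 σ(d)` given by the side of the line `p → q` on
which `d` lies. [folklore] -/
theorem dp_key (p q d : ℂ) (t : ℝ) :
    dist d (p + (⟨1 / 2, t⟩ : ℂ) * (q - p)) ^ 2 - dist p (p + (⟨1 / 2, t⟩ : ℂ) * (q - p)) ^ 2 =
      Complex.normSq (d - p) - (starRingEnd ℂ (q - p) * (d - p)).re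
        - 2 * t * (starRingEnd ℂ (q - p) * (d - p)).im := by
  simp only [Complex.dist_eq, Complex.sq_norm, Complex.normSq_apply, Complex.sub_re, Complex.sub_im,
    Complex.add_re, Complex.add_im, Complex.mul_re, Complex.mul_im, Complex.conj_re,
    Complex.conj_im]
  ring

/-- Every centre `c t = p + (1/2 + t i)(q − p)` of the pencil is equidistant from `p` and `q`.
[folklore] -/
theorem dp_dist_q (p q : ℂ) (t : ℝ) :
    dist q (p + (⟨1 / 2, t⟩ : ℂ) * (q - p)) = dist p (p + (⟨1 / 2, t⟩ : ℂ) * (q - p)) := by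
  rw [← sq_eq_sq₀ dist_nonneg dist_nonneg]
  simp only [Complex.dist_eq, Complex.sq_norm, Complex.normSq_apply, Complex.sub_re, Complex.sub_im,
    Complex.add_re, Complex.add_im, Complex.mul_re, Complex.mul_im]
  ring

/-- **Parametrisation of the perpendicular bisector.** For `p ≠ q`, every point `c` equidistant
from `p` and `q` is `c = p + (1/2 + t i)(q − p)` for some real `t`. [folklore] -/
theorem dp_center_param {p q c : ℂ} (hpq : p ≠ q) (h : dist p c = dist q c) :
    ∃ t : ℝ, c = p + (⟨1 / 2, t⟩ : ℂ) * (q - p) := by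
  have hv : q - p ≠ 0 := sub_ne_zero.mpr hpq.symm
  obtain ⟨u, rfl⟩ : ∃ u : ℂ, c = p + u * (q - p) :=
    ⟨(c - p) / (q - p), by rw [div_mul_cancel₀ _ hv]; ring⟩
  refine ⟨u.im, ?_⟩
  have h1 : dist p (p + u * (q - p)) = ‖u‖ * ‖q - p‖ := by
    rw [dist_comm, Complex.dist_eq, add_sub_cancel_left, norm_mul]
  have h2 : dist q (p + u * (q - p)) = ‖u - 1‖ * ‖q - p‖ := by
    rw [dist_comm, Complex.dist_eq, ← norm_mul]
    congr 1
    ring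
  rw [h1, h2] at h
  have h3 : ‖u‖ = ‖u - 1‖ := mul_right_cancel₀ (norm_ne_zero_iff.mpr hv) h
  have h4 : ‖u‖ ^ 2 = ‖u - 1‖ ^ 2 := by rw [h3]
  rw [Complex.sq_norm, Complex.sq_norm, Complex.normSq_apply, Complex.normSq_apply, Complex.sub_re,
    Complex.sub_im, Complex.one_re, Complex.one_im] at h4
  have hre : u.re = 1 / 2 := by linear_combination h4 / 2
  have hu : u = ⟨1 / 2, u.im⟩ := Complex.ext hre rfl
  exact congrArg (fun w : ℂ => p + w * (q - p)) hu

/-- **Pivoting along a pencil (abstract form).** Let `c : ℝ → ℂ` be a family of centres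
equidistant from `p` and `q` whose powers satisfy the pencil identity
`dist(d, c t)² − dist(p, c t)² = A(d) − 2 t σ(d)` for some real functions `A`, `σ`.  If the disc at
parameter `t₀` contains no site of the locally finite set `ω` in its interior and some site `d₀ ∈ ω`
has `σ(d₀) > 0`, then some disc of the family is empty and has a site `z ∈ ω` with `σ(z) > 0` on its
boundary circle, together with `p` and `q`. [folklore] -/
theorem dp_pivot_of_pencil {ω : Set ℂ} {p q d₀ : ℂ} {c : ℝ → ℂ} {σ A : ℂ → ℝ} {t₀ : ℝ}
    (hfin : ∀ K : Set ℂ, IsCompact K → (ω ∩ K).Finite)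
    (hkey : ∀ (d : ℂ) (t : ℝ), dist d (c t) ^ 2 - dist p (c t) ^ 2 = A d - 2 * t * σ d)
    (hq : ∀ t, dist q (c t) = dist p (c t))
    (ht₀ : ∀ d ∈ ω, dist p (c t₀) ≤ dist d (c t₀))
    (hd₀ : d₀ ∈ ω) (hσ₀ : 0 < σ d₀) :
    ∃ z ∈ ω, 0 < σ z ∧ ∃ (c' : ℂ) (r : ℝ),
      dist p c' = r ∧ dist q c' = r ∧ dist z c' = r ∧ ∀ d ∈ ω, r ≤ dist d c' := by
  -- emptiness of the disc at parameter `t` w.r.t. `d`, and membership of `d` in the closed disc,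
  -- as linear inequalities in `t`
  have havoid : ∀ d t, dist p (c t) ≤ dist d (c t) ↔ 2 * t * σ d ≤ A d := fun d t => by
    rw [← sq_le_sq₀ dist_nonneg dist_nonneg]
    constructor <;> intro h <;> linarith [hkey d t]
  have hinside : ∀ d t, dist d (c t) ≤ dist p (c t) ↔ A d ≤ 2 * t * σ d := fun d t => by
    rw [← sq_le_sq₀ dist_nonneg dist_nonneg]
    constructor <;> intro h <;> linarith [hkey d t]
  -- the threshold `τ d` of a left site: `2 τ(d) σ(d) = A(d)`
  obtain ⟨τ, hτ⟩ : ∃ τ : ℂ → ℝ, ∀ d, 0 < σ d → 2 * τ d * σ d = A d :=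
    ⟨fun d => A d / (2 * σ d), fun d hσ => by field_simp⟩
  -- a left site lies ON the circle at its own threshold
  have honcircle : ∀ d, 0 < σ d → dist d (c (τ d)) = dist p (c (τ d)) := fun d hσ => by
    rw [← sq_eq_sq₀ dist_nonneg dist_nonneg]
    linarith [hkey d (τ d), hτ d hσ]
  -- every threshold is at least `t₀`
  have hτ_ge : ∀ d ∈ ω, 0 < σ d → t₀ ≤ τ d := fun d hd hσ => by
    have h1 := (havoid d t₀).1 (ht₀ d hd)
    exact le_of_mul_le_mul_right (by linarith [hτ d hσ]) hσ
  -- the finitely many left sites inside the closed disc at parameter `τ d₀`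
  obtain ⟨S, hS⟩ : ∃ S : Finset ℂ,
      ∀ d, d ∈ S ↔ d ∈ ω ∧ dist d (c (τ d₀)) ≤ dist p (c (τ d₀)) ∧ 0 < σ d := by
    classical
    refine ⟨(hfin _ (isCompact_closedBall (c (τ d₀)) (dist p (c (τ d₀))))).toFinset.filter
      fun d => 0 < σ d, fun d => ?_⟩
    rw [Finset.mem_filter, Set.Finite.mem_toFinset, Set.mem_inter_iff, Metric.mem_closedBall,
      and_assoc]
  have hd₀S : d₀ ∈ S := (hS d₀).2 ⟨hd₀, (honcircle d₀ hσ₀).le, hσ₀⟩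
  -- pivot: a left site with the least threshold
  obtain ⟨z, hzS, hzmin⟩ := S.exists_min_image τ ⟨d₀, hd₀S⟩
  obtain ⟨hzω, -, hzσ⟩ := (hS z).1 hzS
  refine ⟨z, hzω, hzσ, c (τ z), dist p (c (τ z)), rfl, hq _, honcircle z hzσ, fun d hd => ?_⟩
  rw [havoid]
  rcases lt_or_ge 0 (σ d) with hσ | hσ
  · -- a site strictly on the left: its threshold is not below `τ z`
    by_contra hlt
    have hτd : τ d < τ z :=
      lt_of_mul_lt_mul_right (by linarith [hτ d hσ] : τ d * σ d < τ z * σ d) hσ.le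
    have hdz₀ : τ d < τ d₀ := hτd.trans_le (hzmin d₀ hd₀S)
    have hdS : d ∈ S := by
      refine (hS d).2 ⟨hd, (hinside d (τ d₀)).2 ?_, hσ⟩
      have h1 := mul_le_mul_of_nonneg_right hdz₀.le hσ.le
      linarith [hτ d hσ]
    exact absurd (hzmin d hdS) (not_le.mpr hτd)
  · -- a site on the right of, or on, the line `p → q`: the constraint weakens as `t` grows
    have h1 := (havoid d t₀).1 (ht₀ d hd)
    have h2 := mul_le_mul_of_nonneg_left hσ (sub_nonneg.2 (hτ_ge z hzω hzσ))
    linarith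

/-- **Delaunay pivoting** (stub `delaunay_pivot_exists_third` of the line
`moebius-exact-delaunay-dilation-ward`).  For a locally finite `ω ⊆ ℂ`, a Delaunay pair `p ≠ q` of
`ω` (empty circumscribed disc rule) and a site of `ω` strictly to the left of the directed line
`p → q`, some empty circumscribed disc through `p`, `q` has a third site `z ∈ ω`, strictly to the
left of `p → q`, on its boundary circle. [folklore] -/
theorem delaunay_pivot_exists_third : ∀ (ω : Set ℂ) (p q : ℂ), p ∈ ω → q ∈ ω → p ≠ q → (∀ K : Set ℂ, IsCompact K → (ω ∩ K).Finite) → Literature.Probability.LatticeModels.IsDelaunayPair ω p q → (∃ d ∈ ω, 0 < (starRingEnd ℂ (q - p) * (d - p)).im) → ∃ z ∈ ω, 0 < (starRingEnd ℂ (q - p) * (z - p)).im ∧ ∃ (c : ℂ) (r : ℝ), dist p c = r ∧ dist q c = r ∧ dist z c = r ∧ ∀ d ∈ ω, r ≤ dist d c := by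
  intro ω p q _ _ hpq hfin hDel hleft
  obtain ⟨d₀, hd₀, hσ₀⟩ := hleft
  obtain ⟨c₀, hc₀, hT₀⟩ :=
    Literature.Probability.LatticeModels.isDelaunayPair_iff_exists_center.1 hDel
  obtain ⟨t₀, rfl⟩ := dp_center_param hpq hc₀
  exact dp_pivot_of_pencil (c := fun t : ℝ => p + (⟨1 / 2, t⟩ : ℂ) * (q - p))
    (σ := fun d => (starRingEnd ℂ (q - p) * (d - p)).im)
    (A := fun d => Complex.normSq (d - p) - (starRingEnd ℂ (q - p) * (d - p)).re)
    hfin (fun d t => dp_key p q d t) (fun t => dp_dist_q p q t) hT₀ hd₀ hσ₀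

end Summit.CriticalPhenomena.CardyFormulaZ2.Cruxes.VoronoiHubFromSmirnov.MoebiusExactDelaunayDilationWard

end
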